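import Mathlib
import HarnessLib
import HarnessLib.Audit
import Summits.CriticalPhenomena.PercolationContinuityZ3.Theorems.PercNearOneGluingNoHeavyLowerTailHexMSMatchTightHall
import Summits.CriticalPhenomena.PercolationContinuityZ3.Theorems.SahiMasterFamilyFInequalityMSTightMain

/-!
# Conjecture (MATCH), two dead classes: the MS-equality structure is a theorem — the Δ-MS-tight case is unconditional (hp-7 gen 70)

Support file for crux `stmt-CriticalPhenomena-4575` (route `PercNearOneGluingNoHeavy`), hull-port seat `prim-hp-7` (generation 70);
`--supports stmt-CriticalPhenomena-4575`.  No `sorry`, no definition.  Memo: `run/shared/lean/prim/prim-hp-7/FROM-prim-hp-7-g70-MS-EQUALITY.md`.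

Gen 69 (`…HexMSMatchTightHall`) proved Hall's condition for every Δ-MS-tight two-class dead family MODULO the named obligation
`MSEqualityStructure α` ("every family `G` with `#(G \\ G) = #G` is a twisted product `{a ∪ (I \ d₁) ∪ d₂}` of two difference-closed
families"), verified exhaustively on `2^[4]` and attributed to Aharoni–Holzman (1993, unheld).  This file DISCHARGES it:

* `symmDiff_mem_diffs_of_pivot`, `diffs_eq_image_symmDiff`, `symmDiff_mem_of_mem_diffs` — for a PIVOT `c` of `G` (`c ∪ g, c ∩ g ∈ G` for all
  `g ∈ G`) and `#(G \\ G) ≤ #G`: **`G \\ G = {c ∆ g : g ∈ G}`** (the symmetric-difference form of MS-equality), hence `c ∆ e ∈ G` for every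
  difference `e`;
* `mix_mem_of_pivot`, `tp_mem_of_pivot`, `diffClosed_image_sdiff_left/right`, `eq_twistedProduct_of_pivot`, `mem_diffs_pivot_split` — so `G` is
  the twisted product of the difference-closed families `{c \ g}` and `{g \ c}` over `c`, and every difference splits along `c`;
* `msEqualityStructure_holds : MSEqualityStructure α` — pivot EXISTENCE is the tree theorem
  `TwistedAD.exists_pivot_of_card_diffs_eq_card` (`…SahiMasterFamilyFInequalityMSTightMain`, seat `prim-master-conj`), which gen 69 had
  not seen; combined with the above it gives the obligation verbatim (with `a = ∅`, `I = c`);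
* `card_le_card_biUnion_candidates_of_tight'` — **Hall's condition `#A ≤ #N(A)` for `A = cl F`, `F` any Δ-MS-tight two-class dead
  family, now UNCONDITIONAL** (gen 69's `card_le_card_biUnion_candidates_of_tight` with its hypothesis discharged).

(An independent proof of pivot existence by the coordinate split — no-straddling lemma for nested twisted products — was also
kernel-checked this generation, `run/shared/lean/prim/prim-hp-7/code/gen70/MSEq_all.lean`; it is not landed, the tree already has one.)
-/

namespace Summit.CriticalPhenomena.PercolationContinuityZ3.Theorems

namespace GeneratedDonors

open Finset FinsetFamily

variable {α : Type*} [DecidableEq α]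

section Pivot

variable {G : Finset (Finset α)} {c : Finset α}

/-- If `c` is a PIVOT of `G` (`c ∪ g ∈ G` and `c ∩ g ∈ G` for every `g ∈ G`), then every `c ∆ g` (`g ∈ G`) is a difference
of two members of `G`, namely `(c ∪ g) \ (c ∩ g)`. -/
theorem symmDiff_mem_diffs_of_pivot (hc : ∀ g ∈ G, c ∪ g ∈ G ∧ c ∩ g ∈ G) {g : Finset α} (hg : g ∈ G) :
    symmDiff c g ∈ G \\ G := by
  rw [Finset.mem_diffs]
  refine ⟨c ∪ g, (hc g hg).1, c ∩ g, (hc g hg).2, ?_⟩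
  ext i; simp only [mem_sdiff, mem_union, mem_inter, mem_symmDiff]; grind

/-- A pivot of a nonempty family is a member (`c = c ∩ (c ∪ g)`). -/
theorem pivot_mem (hne : G.Nonempty) (hc : ∀ g ∈ G, c ∪ g ∈ G ∧ c ∩ g ∈ G) : c ∈ G := by
  obtain ⟨g, hg⟩ := hne
  have h := (hc _ (hc g hg).1).2
  have e : c ∩ (c ∪ g) = c := by ext i; simp only [mem_inter, mem_union]; grind
  rwa [e] at h

/-- **Tight + pivot ⟹ the differences are exactly the `c ∆ g`.**  If `#(G \\ G) ≤ #G` (equality in Marica–Schönheim) and `c`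
is a pivot, then `G \\ G = {c ∆ g : g ∈ G}`. -/
theorem diffs_eq_image_symmDiff (hcard : #(G \\ G) ≤ #G) (hc : ∀ g ∈ G, c ∪ g ∈ G ∧ c ∩ g ∈ G) :
    G \\ G = G.image (symmDiff c) := by
  symm
  apply eq_of_subset_of_card_le
  · intro e he
    obtain ⟨g, hg, rfl⟩ := mem_image.mp he
    exact symmDiff_mem_diffs_of_pivot hc hg
  · rw [card_image_of_injective _ (symmDiff_right_injective c)]; exact hcard

/-- Hence `c ∆ e ∈ G` for every difference `e ∈ G \\ G`. -/
theorem symmDiff_mem_of_mem_diffs (hcard : #(G \\ G) ≤ #G) (hc : ∀ g ∈ G, c ∪ g ∈ G ∧ c ∩ g ∈ G)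
    {e : Finset α} (he : e ∈ G \\ G) : symmDiff c e ∈ G := by
  rw [diffs_eq_image_symmDiff hcard hc] at he
  obtain ⟨g, hg, rfl⟩ := mem_image.mp he
  rwa [symmDiff_symmDiff_cancel_left]

/-- The MIX of two members: `(c ∩ g) ∪ (h \ c) ∈ G` (its `c ∆` is the difference `(c ∪ h) \ (c ∩ g)`). -/
theorem mix_mem_of_pivot (hcard : #(G \\ G) ≤ #G) (hc : ∀ g ∈ G, c ∪ g ∈ G ∧ c ∩ g ∈ G)
    {g h : Finset α} (hg : g ∈ G) (hh : h ∈ G) : (c ∩ g) ∪ (h \ c) ∈ G := by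
  have hd : (c ∪ h) \ (c ∩ g) ∈ G \\ G := Finset.mem_diffs.mpr ⟨c ∪ h, (hc h hh).1, c ∩ g, (hc g hg).2, rfl⟩
  have hm := symmDiff_mem_of_mem_diffs hcard hc hd
  convert hm using 1
  ext i; simp only [mem_union, mem_inter, mem_sdiff, mem_symmDiff]; grind

/-- **Twisted-product structure from a pivot**: with `D₁ = {c \ g}` and `D₂ = {g \ c}`, every `(c \ e₁) ∪ e₂` (`eᵢ ∈ Dᵢ`) is a member. -/
theorem tp_mem_of_pivot (hcard : #(G \\ G) ≤ #G) (hc : ∀ g ∈ G, c ∪ g ∈ G ∧ c ∩ g ∈ G) :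
    ∀ e₁ ∈ G.image (c \ ·), ∀ e₂ ∈ G.image (· \ c), (c \ e₁) ∪ e₂ ∈ G := by
  intro e₁ he₁ e₂ he₂
  obtain ⟨g, hg, rfl⟩ := mem_image.mp he₁
  obtain ⟨h, hh, rfl⟩ := mem_image.mp he₂
  have hm := mix_mem_of_pivot hcard hc hg hh
  convert hm using 1
  ext i; simp only [mem_union, mem_inter, mem_sdiff]; grind

/-- `D₁ = {c \ g : g ∈ G}` is difference-closed. -/
theorem diffClosed_image_sdiff_left (hcard : #(G \\ G) ≤ #G) (hc : ∀ g ∈ G, c ∪ g ∈ G ∧ c ∩ g ∈ G) :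
    ∀ d ∈ G.image (c \ ·), ∀ d' ∈ G.image (c \ ·), d \ d' ∈ G.image (c \ ·) := by
  intro d hd d' hd'
  obtain ⟨g, hg, rfl⟩ := mem_image.mp hd
  obtain ⟨h, hh, rfl⟩ := mem_image.mp hd'
  have he : h \ g ∈ G \\ G := Finset.mem_diffs.mpr ⟨h, hh, g, hg, rfl⟩
  have hm := symmDiff_mem_of_mem_diffs hcard hc he
  refine mem_image.mpr ⟨_, hm, ?_⟩
  ext i; simp only [mem_sdiff, mem_symmDiff]; grind

/-- `D₂ = {g \ c : g ∈ G}` is difference-closed. -/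
theorem diffClosed_image_sdiff_right (hcard : #(G \\ G) ≤ #G) (hc : ∀ g ∈ G, c ∪ g ∈ G ∧ c ∩ g ∈ G) :
    ∀ d ∈ G.image (· \ c), ∀ d' ∈ G.image (· \ c), d \ d' ∈ G.image (· \ c) := by
  intro d hd d' hd'
  obtain ⟨g, hg, rfl⟩ := mem_image.mp hd
  obtain ⟨h, hh, rfl⟩ := mem_image.mp hd'
  have he : g \ h ∈ G \\ G := Finset.mem_diffs.mpr ⟨g, hg, h, hh, rfl⟩
  have hm := symmDiff_mem_of_mem_diffs hcard hc he
  refine mem_image.mpr ⟨_, hm, ?_⟩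
  ext i; simp only [mem_sdiff, mem_symmDiff]; grind

/-- A tight family with a pivot IS the twisted product of `{c \ g}` and `{g \ c}` over the pivot. -/
theorem eq_twistedProduct_of_pivot (hcard : #(G \\ G) ≤ #G) (hc : ∀ g ∈ G, c ∪ g ∈ G ∧ c ∩ g ∈ G) :
    G = ((G.image (c \ ·)) ×ˢ (G.image (· \ c))).image (fun e => (c \ e.1) ∪ e.2) := by
  ext f
  constructor
  · intro hf
    refine mem_image.mpr ⟨(c \ f, f \ c), mem_product.mpr ⟨mem_image_of_mem _ hf, mem_image_of_mem _ hf⟩, ?_⟩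
    ext i; simp only [mem_union, mem_sdiff]; grind
  · intro hf
    obtain ⟨⟨e₁, e₂⟩, he, rfl⟩ := mem_image.mp hf
    rw [mem_product] at he
    exact tp_mem_of_pivot hcard hc _ he.1 _ he.2

/-- Every difference `e ∈ G \\ G` splits as `e ∩ c ∈ D₁`, `e \ c ∈ D₂`. -/
theorem mem_diffs_pivot_split (hcard : #(G \\ G) ≤ #G) (hc : ∀ g ∈ G, c ∪ g ∈ G ∧ c ∩ g ∈ G)
    {e : Finset α} (he : e ∈ G \\ G) : e ∩ c ∈ G.image (c \ ·) ∧ e \ c ∈ G.image (· \ c) := by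
  rw [diffs_eq_image_symmDiff hcard hc] at he
  obtain ⟨g, hg, rfl⟩ := mem_image.mp he
  refine ⟨mem_image.mpr ⟨g, hg, ?_⟩, mem_image.mpr ⟨g, hg, ?_⟩⟩
  · ext i; simp only [mem_sdiff, mem_inter, mem_symmDiff]; grind
  · ext i; simp only [mem_sdiff, mem_symmDiff]; grind

end Pivot

section MSEquality

/-- **`MSEqualityStructure` holds**: every family `G` with `#(G \\ G) = #G` is a twisted product `{a ∪ (I \ d₁) ∪ d₂ : d₁ ∈ D₁, d₂ ∈ D₂}`
of two difference-closed families (`a = ∅`, `I` = a pivot, `D₁ = {I \ g}`, `D₂ = {g \ I}`).  Pivot existence: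
`TwistedAD.exists_pivot_of_card_diffs_eq_card`. -/
theorem msEqualityStructure_holds : MSEqualityStructure α := by
  intro G ht
  rcases G.eq_empty_or_nonempty with rfl | hne
  · exact ⟨∅, ∅, ∅, ∅, by simp, by simp, by simp, by simp, by simp⟩
  obtain ⟨p, -, hp⟩ := TwistedAD.exists_pivot_of_card_diffs_eq_card G ht hne
  refine ⟨∅, p, G.image (p \ ·), G.image (· \ p), ?_, ?_, diffClosed_image_sdiff_left ht.le hp,
    diffClosed_image_sdiff_right ht.le hp, ?_⟩
  · intro d hd
    obtain ⟨g, _, rfl⟩ := mem_image.mp hd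
    exact sdiff_subset
  · intro d hd
    obtain ⟨g, _, rfl⟩ := mem_image.mp hd
    rw [empty_union]; exact disjoint_sdiff_self_left
  · rw [show (fun e : Finset α × Finset α => ∅ ∪ (p \ e.1) ∪ e.2) = (fun e => (p \ e.1) ∪ e.2) from
      funext fun e => by rw [empty_union]]
    exact eq_twistedProduct_of_pivot ht.le hp

/-- The symmetric-difference form of MS-equality (gen 69 memo (AH‴)): `#(G \\ G) = #G`, `G ≠ ∅` ⟹ some member `c` has
`{c ∆ e : e ∈ G \\ G} = G`. -/
theorem exists_image_symmDiff_diffs_eq (G : Finset (Finset α)) (ht : #(G \\ G) = #G) (hne : G.Nonempty) :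
    ∃ c ∈ G, (G \\ G).image (symmDiff c) = G := by
  obtain ⟨c, hc, hp⟩ := TwistedAD.exists_pivot_of_card_diffs_eq_card G ht hne
  refine ⟨c, hc, ?_⟩
  rw [diffs_eq_image_symmDiff ht.le hp, image_image]
  have e1 : (symmDiff c ∘ symmDiff c) = id := funext fun g => symmDiff_symmDiff_cancel_left c g
  rw [e1, image_id]

variable {U : Finset α} {𝒟 : Finset (Finset α)} {x : Finset α → ZMod 6}

/-- **The Δ-MS-tight case of two-class (MATCH), unconditional.**  If `F` is a family of dead members with labels in `{ℓ, ℓ+1}` and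
`#(cl(F \\ F)) = 2 #F`, then `A = F ∪ co F` satisfies Hall's condition `#A ≤ #(⋃_{a ∈ A} candidates a)`. -/
theorem card_le_card_biUnion_candidates_of_tight'
    (hU : ∀ b ∈ 𝒟, b ⊆ U) (hco : ∀ b ∈ 𝒟, U \ b ∈ 𝒟) (hanti : ∀ b ∈ 𝒟, x (U \ b) = x b + 3)
    {F : Finset (Finset α)} (hF : F ⊆ dead U 𝒟 x) {ℓ : ZMod 6} (hlab : ∀ f ∈ F, x f = ℓ ∨ x f = ℓ + 1)
    (htight : #((F \\ F) ∪ (F \\ F).image (fun z => U \ z)) = 2 * #F) :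
    #(F ∪ F.image fun f => U \ f) ≤ #((F ∪ F.image fun f => U \ f).biUnion (candidates 𝒟 x)) :=
  card_le_card_biUnion_candidates_of_tight msEqualityStructure_holds hU hco hanti hF hlab htight

end MSEquality

end GeneratedDonors

end Summit.CriticalPhenomena.PercolationContinuityZ3.Theorems
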